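import Summits.NavierStokesRegularity.NavierStokesRegularity.Theorems.ExtremiserTransienceZoneTransversalityDefs
import Summits.NavierStokesRegularity.NavierStokesRegularity.Theorems.ExtremiserTransienceKStarAttainedHalfSpaceVariation
import HarnessLib

/-!
# Route `ExtremiserTransience`, crux `NearExtremalTransiencePerFlow` (stmt-NavierStokesRegularity-26567),
# LINES g13-α `budget_cut` / g13-β `relay` (ns-idea-5 g13): THE STATEMENTS OF THE TWO LINES (texts of record)

Texts of record, VERBATIM §1 of the files-only skeletons
`Summits/NavierStokesRegularity/NavierStokesRegularity/Cruxes/NearExtremalTransiencePerFlow/Lines/budget_cut.lean`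
(planner ns-idea-5 g13, crux-write ae20d73eeec6, lines :148 / :167 / :188 / :207; critic of record idea-crit-4 g10, PASS B 15:23:42Z) and
`Summits/NavierStokesRegularity/NavierStokesRegularity/Cruxes/NearExtremalTransiencePerFlow/Lines/relay.lean` REV 2
(crux-write 09c2e443f072, lines :126 / :149; PASS B, restamp by hash 15:34:28Z), so that the proved flanks W♭⁺ / R♭, the cuts and the
sandwich (Theorems files `…PinnedDepletionCleanLockedWindowAtScale`, `…PinnedDepletionSandwich`, `…PinnedDepletionRelayObstruction`,
whose hypotheses are these bodies unfolded) can be cited BY NAME on the Theorems side (a Theorems file may not import a `Cruxes/`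
skeleton), and so that the JUNCTION of the two lines has a Theorems-side name:

* `PinnedDepletedFraction` — the junction = the REPAIRED heart: X♭ `DepletedFraction` (line of record g12-β, texts p720463
  `…Theorems.ExtremiserTransienceDepletedFractionDefs`) made PER VIOLATOR (`IsViolator C ν T u p →`, so `ε` may depend on the flow) and
  PINNED (`M = C√ν/√(T−t)`, the Type-I envelope).  Recorded g13 finding (card `Lines/budget_cut.md` §X♭-autopsy; endorsed at referee
  level by idea-crit-4 g10 15:05:25Z, class MISSTATED, repaired statement `C′` = this junction): X♭ as typed (`∃ ε` before `∀ flows`,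
  free window height `M`) is refutable by a near-extremal bulk plus a vanishing divergence-free ripple at an oversized `M`; the pin and
  the per-violator quantifier exclude that scheme.  OPEN.
* `CleanLockedWindowAtScale` — W♭⁺ (flow side): the landed W♭ `CleanLockedWindow` with the extra conjunct `M = C√ν/√(T−τ)`
  (PROVED: `PinnedDepletion.cleanLockedWindowAtScale_holds`, whose type is this body verbatim).
* `SmallBudgetDepletion` — K♭ (g13-α flank, per violator, pinned; believed provable, XL): windows whose start slice has enstrophy budget
  `Z(t) ≤ N₀·(Mν)` deplete (`∀ N₀ ∃ ε`).  OPEN.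
* `CrowdDepletion` — C♭ (g13-α HEART): `∃ N₀ ε`, windows with `N₀·(Mν) ≤ Z(t)` deplete («unbounded cell multiplication»).  OPEN.
* `RelayObstruction` — R♭ (g13-β flank, abstract real analysis on a window; PROVED: `PinnedDepletion.relayObstruction_holds`, type =
  this body verbatim): individually transient cells with one-sided persistent weights cannot relay near-extremality.
* `CellRelayDecomposition` — D♭ (g13-β HEART, «strong pinned depletion, cell-licensed»): every pinned admissible window of a violator
  carries measurable weight/quotient families with the R♭ hypotheses at `κ = κ⋆` (rev 2: ONE-SIDED persistence against the window start)
  DOMINATING the flow's depletion inequality.  OPEN.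

Kernel facts over these texts (Theorems side, ns `…PinnedDepletion`): `PinnedDepletedFraction → NearExtremalTransiencePerFlow` (the
sandwich through W♭⁺), `SmallBudgetDepletion → CrowdDepletion → PinnedDepletedFraction` (budget cut), `CellRelayDecomposition →
PinnedDepletedFraction` (relay cut through R♭), `DepletedFraction → PinnedDepletedFraction` (the junction asks for less than the line of
record).  The definitions are definitionally equal to the skeletons' (same bodies, same opens).  HONEST FRAMING: definitions only, about
hypothetical Type-I singular flows violating the crux; K♭, C♭, D♭, the junction, the crux ⟨26567⟩ and NS regularity are OPEN; nothing
about Navier–Stokes regularity or blow-up is proved; no summit is proved by a line.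
-/

noncomputable section

open scoped Topology InnerProductSpace RealInnerProductSpace ENNReal ContDiff
open MeasureTheory Filter Set Metric
open Literature.Analysis.FluidPDE
open Summit.NavierStokesRegularity.NavierStokesRegularity.Theorems
open Summit.NavierStokesRegularity.NavierStokesRegularity.Theorems.DepletionLadder.KStar.HalfSpace
open Summit.NavierStokesRegularity.NavierStokesRegularity.Theorems.NearExtremalTransiencePerFlow.ZoneTransversality

namespace Summit.NavierStokesRegularity.NavierStokesRegularity.Theorems.NearExtremalTransiencePerFlow.PinnedDepletion

-- the summit's namespace repeats the problem name by convention (D-0017)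
set_option linter.dupNamespace false
set_option linter.style.longLine false

/-- **W♭⁺ — CLEAN LOCKED WINDOW AT THE TYPE-I SCALE (flow side; PROVED: `cleanLockedWindowAtScale_holds`).**  The landed W♭
`CleanLockedWindow` (`…DepletedFraction.cleanLockedWindow_holds`, p719836) with ONE extra conjunct exporting the SCALE PIN
`M = C√ν/√(T−τ)` of its window (the landed proof defines `M` so; the pin makes `M` comparable to the true height by Leray's lower rate,
and `M·ν` the natural cell enstrophy).  A violator carries a coefficient `k` with the strict-efficiency read-back, constants
`Θ, G, H, c_w > 0`, and for every level `κ⋆/2 ≤ m < κ⋆`, every `η > 0`, every `0 < τ₁ ≤ c_w` ONE pinned packaged instant `τ` whose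
forward window is `η`-clean.  (Text VERBATIM `budget_cut.lean` :148 = `relay.lean` :107.) -/
def CleanLockedWindowAtScale : Prop :=
  ∀ (C ν T : ℝ) (u : ℝ → EuclideanSpace ℝ (Fin 3) → EuclideanSpace ℝ (Fin 3)) (p : ℝ → EuclideanSpace ℝ (Fin 3) → ℝ),
    IsViolator C ν T u p →
    ∃ (k : ℝ → ℝ) (Θ G H c_w : ℝ),
      (∀ t ∈ Set.Ico 0 T, ∀ m : ℝ, 0 ≤ m → m < k t → ∃ M : ℝ, (∀ x, ‖u t x‖ ≤ M) ∧
        m * M * Real.sqrt (∫ x, ‖curl (u t) x‖ ^ 2) * Real.sqrt (∫ x, frobeniusNormSq (fderiv ℝ (curl (u t)) x)) <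
          |∫ x, ⟪curl (u t) x, fderiv ℝ (u t) x (curl (u t) x)⟫_ℝ|) ∧
      0 < Θ ∧ 0 < G ∧ 0 < H ∧ 0 < c_w ∧
      ∀ m : ℝ, kStar / 2 ≤ m → m < kStar → ∀ η : ℝ, 0 < η → ∀ τ₁ : ℝ, 0 < τ₁ → τ₁ ≤ c_w →
        ∃ τ M : ℝ, 0 ≤ τ ∧ 0 < M ∧ τ + τ₁ * ν / M ^ 2 < T ∧ M = C * Real.sqrt ν / Real.sqrt (T - τ) ∧ (∀ x, ‖u τ x‖ ≤ M) ∧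
          (∫ x, ‖curl (u τ) x‖ ^ 2) ≤ Θ * (ν / M) ^ 2 * (∫ x, frobeniusNormSq (fderiv ℝ (curl (u τ)) x)) ∧
          (∀ x, ‖fderiv ℝ (u τ) x‖ ≤ G * M ^ 2 / ν) ∧
          (∀ t' ∈ Set.Icc τ (τ + τ₁ * ν / M ^ 2), ∀ x, ‖u t' x‖ ≤ H * M) ∧
          volume ({σ : ℝ | k σ ≤ m} ∩ Set.Icc τ (τ + τ₁ * ν / M ^ 2)) ≤ ENNReal.ofReal (η * (τ₁ * ν / M ^ 2))

/-- **K♭ — SMALL-BUDGET DEPLETION (FLANK of g13-α, per violator, pinned; believed PROVABLE, XL; OPEN).**  In a violator flow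
(`IsViolator C ν T u p`), every PINNED admissible window — height bound `M = C√ν/√(T−t)` at `t` (the Type-I envelope), Taylor lock
`Z(t) ≤ Θ(ν/M)²P(t)`, gradient `≤ GM²/ν` at `t`, heights `≤ HM` on `I = [t, t + τ₁ν/M²] ⊂ [0,T)` — whose start slice has enstrophy
budget AT MOST `N₀` cell units, `Z(t) ≤ N₀·(Mν)`, has `ε`-depleted times of measure `≥ ε|I|`.
`∀ violator ∀ Θ G H τ₁ N₀ > 0 ∃ ε > 0 ∀ pinned windows`.  (Text VERBATIM `budget_cut.lean` :167.) -/
def SmallBudgetDepletion : Prop :=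
  ∀ (C ν T : ℝ) (u : ℝ → EuclideanSpace ℝ (Fin 3) → EuclideanSpace ℝ (Fin 3)) (p : ℝ → EuclideanSpace ℝ (Fin 3) → ℝ),
    IsViolator C ν T u p →
    ∀ (Θ G H τ₁ N₀ : ℝ), 0 < Θ → 0 < G → 0 < H → 0 < τ₁ → 0 < N₀ → ∃ ε : ℝ, 0 < ε ∧
    ∀ (t M : ℝ), 0 ≤ t → 0 < M → t + τ₁ * ν / M ^ 2 < T → M = C * Real.sqrt ν / Real.sqrt (T - t) →
      (∀ x, ‖u t x‖ ≤ M) →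
      (∫ x, ‖curl (u t) x‖ ^ 2) ≤ Θ * (ν / M) ^ 2 * (∫ x, frobeniusNormSq (fderiv ℝ (curl (u t)) x)) →
      (∀ x, ‖fderiv ℝ (u t) x‖ ≤ G * M ^ 2 / ν) →
      (∀ t' ∈ Set.Icc t (t + τ₁ * ν / M ^ 2), ∀ x, ‖u t' x‖ ≤ H * M) →
      (∫ x, ‖curl (u t) x‖ ^ 2) ≤ N₀ * (M * ν) →
      ENNReal.ofReal (ε * (τ₁ * ν / M ^ 2)) ≤
        volume ({t' : ℝ | ∀ M' : ℝ, (∀ x, ‖u t' x‖ ≤ M') →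
            |∫ x, ⟪curl (u t') x, fderiv ℝ (u t') x (curl (u t') x)⟫_ℝ| ≤
              (kStar - ε) * M' * Real.sqrt (∫ x, ‖curl (u t') x‖ ^ 2) *
                Real.sqrt (∫ x, frobeniusNormSq (fderiv ℝ (curl (u t')) x))} ∩
          Set.Icc t (t + τ₁ * ν / M ^ 2))

/-- **C♭ — CROWD DEPLETION (HEART of g13-α, per violator, pinned, OPEN).**  In a violator flow, for every window package
`(Θ, G, H, τ₁)` there are a budget threshold `N₀` and a fraction `ε > 0` such that every PINNED admissible window (`M = C√ν/√(T−t)`)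
whose start slice carries AT LEAST `N₀` cell units of enstrophy, `N₀·(Mν) ≤ Z(t)`, has `ε`-depleted times of measure `≥ ε|I|`.
`∀ violator ∀ Θ G H τ₁ > 0 ∃ N₀ ε > 0 ∀ pinned windows`.  (X♭ restricted to CROWDED late windows of ONE violator: the residual enemy
«unbounded cell multiplication».  Text VERBATIM `budget_cut.lean` :188.) -/
def CrowdDepletion : Prop :=
  ∀ (C ν T : ℝ) (u : ℝ → EuclideanSpace ℝ (Fin 3) → EuclideanSpace ℝ (Fin 3)) (p : ℝ → EuclideanSpace ℝ (Fin 3) → ℝ),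
    IsViolator C ν T u p →
    ∀ (Θ G H τ₁ : ℝ), 0 < Θ → 0 < G → 0 < H → 0 < τ₁ → ∃ N₀ ε : ℝ, 0 < N₀ ∧ 0 < ε ∧
    ∀ (t M : ℝ), 0 ≤ t → 0 < M → t + τ₁ * ν / M ^ 2 < T → M = C * Real.sqrt ν / Real.sqrt (T - t) →
      (∀ x, ‖u t x‖ ≤ M) →
      (∫ x, ‖curl (u t) x‖ ^ 2) ≤ Θ * (ν / M) ^ 2 * (∫ x, frobeniusNormSq (fderiv ℝ (curl (u t)) x)) →
      (∀ x, ‖fderiv ℝ (u t) x‖ ≤ G * M ^ 2 / ν) →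
      (∀ t' ∈ Set.Icc t (t + τ₁ * ν / M ^ 2), ∀ x, ‖u t' x‖ ≤ H * M) →
      N₀ * (M * ν) ≤ (∫ x, ‖curl (u t) x‖ ^ 2) →
      ENNReal.ofReal (ε * (τ₁ * ν / M ^ 2)) ≤
        volume ({t' : ℝ | ∀ M' : ℝ, (∀ x, ‖u t' x‖ ≤ M') →
            |∫ x, ⟪curl (u t') x, fderiv ℝ (u t') x (curl (u t') x)⟫_ℝ| ≤
              (kStar - ε) * M' * Real.sqrt (∫ x, ‖curl (u t') x‖ ^ 2) *
                Real.sqrt (∫ x, frobeniusNormSq (fderiv ℝ (curl (u t')) x))} ∩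
          Set.Icc t (t + τ₁ * ν / M ^ 2))

/-- **The JUNCTION `PinnedDepletedFraction` — X♭ per violator at pinned windows (the REPAIRED heart `C′`, OPEN).**  In a violator flow,
for every window package `(Θ, G, H, τ₁)` there is `ε > 0` (it may depend on the violator) such that every PINNED admissible window
(`M = C√ν/√(T−t)`, Taylor lock, gradient, heights) has `ε`-depleted times of measure `≥ ε|I|`.  Both g13 lines cut THIS
(K♭ ∧ C♭ ⇒ it; D♭ ⇒ it via R♭) and THIS closes the crux by the pinned sandwich.  (Text VERBATIM `budget_cut.lean` :207 =
`relay.lean` :174.) -/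
def PinnedDepletedFraction : Prop :=
  ∀ (C ν T : ℝ) (u : ℝ → EuclideanSpace ℝ (Fin 3) → EuclideanSpace ℝ (Fin 3)) (p : ℝ → EuclideanSpace ℝ (Fin 3) → ℝ),
    IsViolator C ν T u p →
    ∀ (Θ G H τ₁ : ℝ), 0 < Θ → 0 < G → 0 < H → 0 < τ₁ → ∃ ε : ℝ, 0 < ε ∧
    ∀ (t M : ℝ), 0 ≤ t → 0 < M → t + τ₁ * ν / M ^ 2 < T → M = C * Real.sqrt ν / Real.sqrt (T - t) →
      (∀ x, ‖u t x‖ ≤ M) →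
      (∫ x, ‖curl (u t) x‖ ^ 2) ≤ Θ * (ν / M) ^ 2 * (∫ x, frobeniusNormSq (fderiv ℝ (curl (u t)) x)) →
      (∀ x, ‖fderiv ℝ (u t) x‖ ≤ G * M ^ 2 / ν) →
      (∀ t' ∈ Set.Icc t (t + τ₁ * ν / M ^ 2), ∀ x, ‖u t' x‖ ≤ H * M) →
      ENNReal.ofReal (ε * (τ₁ * ν / M ^ 2)) ≤
        volume ({t' : ℝ | ∀ M' : ℝ, (∀ x, ‖u t' x‖ ≤ M') →
            |∫ x, ⟪curl (u t') x, fderiv ℝ (u t') x (curl (u t') x)⟫_ℝ| ≤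
              (kStar - ε) * M' * Real.sqrt (∫ x, ‖curl (u t') x‖ ^ 2) *
                Real.sqrt (∫ x, frobeniusNormSq (fderiv ℝ (curl (u t')) x))} ∩
          Set.Icc t (t + τ₁ * ν / M ^ 2))

/-- **R♭ — RELAY OBSTRUCTION (FLANK of g13-β; abstract real analysis on a window; PROVED: `relayObstruction_holds`).**  Weights `wᵢ ≥ 0`
(measurable, `Σᵢ wᵢ ≤ 1` on the window), quotients `qᵢ ≤ κ` (measurable), ONE-SIDED persistence `wᵢ(t') ≤ Λ·wᵢ(a)` against the window
start (growth bounded, decay free) on the window, individual transience `|{qᵢ > κ − δ₀} ∩ I| ≤ ηL` for every `i` ⇒ the convex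
combination `Σᵢ wᵢqᵢ` is `≤ κ − ε` on a set of measure `≥ εL`, for every `0 < ε ≤ min(δ₀/2, 1 − 2Λη)`.  («Has-beens keep their
weight»: no relay of near-extremality among individually transient cells.  Text VERBATIM `relay.lean` REV 2 :126.) -/
def RelayObstruction : Prop :=
  ∀ (κ δ₀ η Λ ε a L : ℝ), 0 < δ₀ → δ₀ ≤ κ → 0 ≤ η → 1 ≤ Λ → 0 < ε → ε ≤ δ₀ / 2 → ε ≤ 1 - 2 * Λ * η → 0 < L →
  ∀ (w q : ℕ → ℝ → ℝ),
    (∀ i, Measurable (w i)) → (∀ i, Measurable (q i)) →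
    (∀ i t', 0 ≤ w i t') →
    (∀ t' ∈ Set.Icc a (a + L), Summable (fun i => w i t') ∧ ∑' i, w i t' ≤ 1) →
    (∀ i, ∀ t' ∈ Set.Icc a (a + L), q i t' ≤ κ) →
    (∀ i, ∀ t' ∈ Set.Icc a (a + L), w i t' ≤ Λ * w i a) →
    (∀ i, volume ({t' : ℝ | κ - δ₀ < q i t'} ∩ Set.Icc a (a + L)) ≤ ENNReal.ofReal (η * L)) →
    ENNReal.ofReal (ε * L) ≤ volume ({t' : ℝ | ∑' i, w i t' * q i t' ≤ κ - ε} ∩ Set.Icc a (a + L))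

/-- **D♭ — CELL RELAY DECOMPOSITION (HEART of g13-β, per violator, pinned, OPEN; label: STRONG PINNED DEPLETION, CELL-LICENSED).**  In a
violator flow, for every window package `(Θ, G, H, τ₁)` there are `δ₀ ∈ (0, κ⋆]`, `η ≥ 0`, `Λ ≥ 1` with `2Λη < 1` such that every PINNED
admissible window (`M = C√ν/√(T−t)`, lock, gradient, heights — the g13-α package) carries measurable weight/quotient families
`w q : ℕ → ℝ → ℝ` on `I = [t, t + τ₁ν/M²]` with: `wᵢ ≥ 0`, `Σᵢ wᵢ ≤ 1`, `qᵢ ≤ κ⋆`, ONE-SIDED persistence `wᵢ(t') ≤ Λ wᵢ(t)` (no weight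
GROWS beyond a factor `Λ` relative to the window START; decay, death and merging-losers are free — rev 2), individual transience
`|{qᵢ > κ⋆ − δ₀} ∩ I| ≤ η|I|`, and DOMINATION of the flow's depletion inequality: `|J(t')| ≤ (Σᵢ wᵢ(t')qᵢ(t'))·M'·√Z(t')·√P(t')` for
every pointwise bound `M'` of `u(t')`, `t' ∈ I`.  The families are an EXISTENTIAL LICENCE, not geometric cells: the one-cell instance
`w₀ ≡ 1`, `q₀ =` the flow's own quotient shows «strong pinned depletion ⇒ D♭ ⇒ (R♭) PinnedDepletedFraction».
(Text VERBATIM `relay.lean` REV 2 :149.) -/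
def CellRelayDecomposition : Prop :=
  ∀ (C ν T : ℝ) (u : ℝ → EuclideanSpace ℝ (Fin 3) → EuclideanSpace ℝ (Fin 3)) (p : ℝ → EuclideanSpace ℝ (Fin 3) → ℝ),
    IsViolator C ν T u p →
    ∀ (Θ G H τ₁ : ℝ), 0 < Θ → 0 < G → 0 < H → 0 < τ₁ →
    ∃ δ₀ η Λ : ℝ, 0 < δ₀ ∧ δ₀ ≤ kStar ∧ 0 ≤ η ∧ 1 ≤ Λ ∧ 2 * Λ * η < 1 ∧
    ∀ (t M : ℝ), 0 ≤ t → 0 < M → t + τ₁ * ν / M ^ 2 < T → M = C * Real.sqrt ν / Real.sqrt (T - t) →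
      (∀ x, ‖u t x‖ ≤ M) →
      (∫ x, ‖curl (u t) x‖ ^ 2) ≤ Θ * (ν / M) ^ 2 * (∫ x, frobeniusNormSq (fderiv ℝ (curl (u t)) x)) →
      (∀ x, ‖fderiv ℝ (u t) x‖ ≤ G * M ^ 2 / ν) →
      (∀ t' ∈ Set.Icc t (t + τ₁ * ν / M ^ 2), ∀ x, ‖u t' x‖ ≤ H * M) →
      ∃ (w q : ℕ → ℝ → ℝ),
        (∀ i, Measurable (w i)) ∧ (∀ i, Measurable (q i)) ∧
        (∀ i t', 0 ≤ w i t') ∧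
        (∀ t' ∈ Set.Icc t (t + τ₁ * ν / M ^ 2), Summable (fun i => w i t') ∧ ∑' i, w i t' ≤ 1) ∧
        (∀ i, ∀ t' ∈ Set.Icc t (t + τ₁ * ν / M ^ 2), q i t' ≤ kStar) ∧
        (∀ i, ∀ t' ∈ Set.Icc t (t + τ₁ * ν / M ^ 2), w i t' ≤ Λ * w i t) ∧
        (∀ i, volume ({t' : ℝ | kStar - δ₀ < q i t'} ∩ Set.Icc t (t + τ₁ * ν / M ^ 2)) ≤
          ENNReal.ofReal (η * (τ₁ * ν / M ^ 2))) ∧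
        (∀ t' ∈ Set.Icc t (t + τ₁ * ν / M ^ 2), ∀ M' : ℝ, (∀ x, ‖u t' x‖ ≤ M') →
          |∫ x, ⟪curl (u t') x, fderiv ℝ (u t') x (curl (u t') x)⟫_ℝ| ≤
            (∑' i, w i t' * q i t') * M' * Real.sqrt (∫ x, ‖curl (u t') x‖ ^ 2) *
              Real.sqrt (∫ x, frobeniusNormSq (fderiv ℝ (curl (u t')) x)))

end Summit.NavierStokesRegularity.NavierStokesRegularity.Theorems.NearExtremalTransiencePerFlow.PinnedDepletion

end
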